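import Summits.QuantumFields.BalabanUV.T4Continuum.Support.RegionFaceFlux
import Summits.QuantumFields.BalabanUV.T4Continuum.Support.DirichletStarRenormTower

/-!
# T⁴ programme, spine node NE2 (U1a), sub-row Δ1 «NE2⁰-Dirichlet» — THE COLUMN CHART OF A BLOCK and «block mean vs face mean»:
# `n^d·‖(Q′ ιB_ν)(y) − Φ(B)(y,ν)‖² ≤ Σ_{in-block ν-pairs} ‖igrad_ν B‖²`

Row NE2 OWNER item O14-a «Δ1-VEC-W1-BOX» (unit `b2b-balaban-t4-ne2-p1`, gen 14; R30 (c), journal 2026-08-20 l.19379 / l.19654), file 2a: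
the chart and the first column estimate behind the block Poincaré inequality around FACE means (file 2b `Support/RegionFaceFluxPoincare`),
with the face-flux field `Φ = faceAvg` of file 1 (`Support/RegionFaceFlux`, p232334) as the coarse datum and the INTERIOR differences `igrad`
(owner p228905 `DirichletStarRenormTower.igrad`: differences between star bonds only, no zero-extension across `∂Ω`) as the fine datum.

 * §1 the COLUMN CHART of a block in direction `ν`: `col y ν j r = bpt y j[ν ↦ 0] + r·e_ν` (`col … (j ν) = bpt y j`, `col … r = bpt y j[ν ↦ r]`
   for `r < n`), the PATH INEQUALITY `‖w b − w a‖² ≤ (b − a)·Σ_{a ≤ s < b} ‖w (s+1) − w s‖²`, and the FIBER COUNT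
   `Σ_j G (j[ν ↦ c]) = n • Σ_{j : j ν = c} G j`.
 * §2 `gI_μ` = `‖igrad_μ B‖²` read on all bonds (`Σ_c gI_μ(c) = nsq (igrad_μ B)`; on a star bond with star `μ`-translate it is
   `n²·‖ιB(c + e_μ) − ιB(c)‖²`); the face mean in the chart `Φ(B)(y,ν) = faceW·Σ_{j : j_ν+1 = n} ιB(bpt y j, ν)`; and
   **`nsq_blockMean_sub_faceAvg_le`** (block `y ∈ S`): `n^d·‖(Q′ ιB_ν)(y) − Φ(B)(y,ν)‖² ≤ Σ_{j : j_ν+1 < n} gI_ν(bpt y j, ν)` — the block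
   mean and the top-face mean of the `ν`-component differ by in-block `ν`-differences (telescoping up the columns, Cauchy–Schwarz, fiber count).

HONEST FRAMING (T4-DAG p. 1).  [folklore] finite lattice calculus on the cell's typed `U = 1` objects; model level (one region = any union of
unit blocks, one averaging scale, finite torus); nothing printed is a hypothesis or a conclusion; W1 NOT proved here; NE2 (U1a) NOT proved;
spine PROVED 0/9 unchanged; NOT [B9] (3.16)/(3.23)–(3.27) as printed; NOT infinite volume / mass gap / Clay.  HONEST DEPENDENCY: continuum YM
on T⁴ ⇐ BetaPertH ∧ nine spine estimates (0/9 proved); BetaPertH ⇐ (D1) ∧ (D4) ∧ CAP+tail; G-an2-4 gates asym, D1 and NE2/3/4.  No `sorry`.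
-/

noncomputable section

open scoped BigOperators ComplexConjugate Matrix
open Finset

namespace Summit.QuantumFields.BalabanUV.T4Continuum.RegionFaceFluxChart

open Literature.MathematicalPhysics.QuantumFieldTheory.Balaban1983to89.B5Prop11Plancherel (Tor fine unitVec)
open Literature.MathematicalPhysics.QuantumFieldTheory.Balaban1983to89.B5Prop11Lower (nsq nsq_nonneg)
open Literature.MathematicalPhysics.QuantumFieldTheory.Balaban1983to89.B5Action121 (sdiff sdiff_mulVec)
open Literature.MathematicalPhysics.QuantumFieldTheory.Balaban1983to89.B5Block118 (bpt tstep tstep_zero tstep_succ QsOp QsOp_mulVec)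
open Literature.MathematicalPhysics.QuantumFieldTheory.Balaban1983to89.B5Blocks16 (blockOf blockOf_bpt sum_blocks bpt_injective)
open Literature.MathematicalPhysics.QuantumFieldTheory.Balaban1983to89.B5AverageCurlStokes (sum_blocks_real)
open Summit.QuantumFields.BalabanUV.T4Continuum
open Summit.QuantumFields.BalabanUV.T4Continuum.SubtypeCompression (ext ext_apply_of ext_apply_of_not nsq_ext)
open Summit.QuantumFields.BalabanUV.T4Continuum.ScalarBlockTrialFunction (digits digits_bpt bpt_add_unitVec_of_lt bpt_add_unitVec_of_eq)
open Summit.QuantumFields.BalabanUV.T4Continuum.RegionGaugeFixedVector (starReg)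
open Summit.QuantumFields.BalabanUV.T4Continuum.RegionStarLineGauge (edig edig_bpt lastD)
open Summit.QuantumFields.BalabanUV.T4Continuum.DirichletStarRenormTower (igrad)
open Summit.QuantumFields.BalabanUV.T4Continuum.RegionFaceFlux (faceW faceAvg)
open Summit.QuantumFields.BalabanUV.Beta.GAN24.DirichletBoxTrace (blockReg bpt_update_add_tstep bpt_eq_update_add)

variable {d : ℕ} (n : ℕ) [NeZero n] (M : Fin d → ℕ) [hM : ∀ μ, NeZero (M μ)] (S : Tor M → Prop) [DecidablePred S]

/-! ## §1 The column chart, the path inequality, the fiber count -/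

section Chart

variable (ν : Fin d)

/-- the COLUMN CHART: the site at height `r` on the `ν`-column of block `y` through the transverse position of `j`. [folklore] -/
def col (y : Tor M) (j : Fin d → Fin n) (r : ℕ) : Tor (fine n M) := bpt n M y (Function.update j ν 0) + tstep (fine n M) ν r

omit hM in
/-- the site of digit `j` sits at height `j ν` of its column. [folklore] -/
theorem col_digit (y : Tor M) (j : Fin d → Fin n) : col n M ν y j (j ν : ℕ) = bpt n M y j := by
  rw [col, ← bpt_eq_update_add]

omit hM in
/-- heights below `n` stay in the block: `col y ν j r = bpt y j[ν ↦ r]`. [folklore] -/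
theorem col_of_lt (y : Tor M) (j : Fin d → Fin n) {r : ℕ} (hr : r < n) :
    col n M ν y j r = bpt n M y (Function.update j ν ⟨r, hr⟩) := by
  rw [col, ← bpt_update_add_tstep n M y j ν ⟨r, hr⟩]

omit hM in
/-- one step up the column. [folklore] -/
theorem col_succ (y : Tor M) (j : Fin d → Fin n) (r : ℕ) : col n M ν y j (r + 1) = col n M ν y j r + unitVec (fine n M) ν := by
  rw [col, col, tstep_succ, add_assoc]

omit hM in
/-- the column depends on `j` only through its transverse digits. [folklore] -/
theorem col_update (y : Tor M) (j : Fin d → Fin n) (a : Fin n) (r : ℕ) : col n M ν y (Function.update j ν a) r = col n M ν y j r := by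
  rw [col, col, Function.update_idem]

omit [NeZero n] hM [DecidablePred S] in
/-- **THE PATH INEQUALITY** on a column: `‖w b − w a‖² ≤ (b − a)·Σ_{a ≤ s < b} ‖w (s+1) − w s‖²`. [folklore] -/
theorem norm_sub_sq_le_path (w : ℕ → ℂ) {a b : ℕ} (hab : a ≤ b) :
    ‖w b - w a‖ ^ 2 ≤ (b - a : ℕ) * ∑ s ∈ Ico a b, ‖w (s + 1) - w s‖ ^ 2 := by
  have htel : w b - w a = ∑ s ∈ Ico a b, (w (s + 1) - w s) := by
    rw [Finset.sum_Ico_eq_sum_range]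
    have h := Finset.sum_range_sub (fun k => w (a + k)) (b - a)
    simp only [add_zero, Nat.add_sub_cancel' hab] at h
    rw [← h]
    exact Finset.sum_congr rfl fun k _ => by rw [add_assoc]
  rw [htel]
  calc ‖∑ s ∈ Ico a b, (w (s + 1) - w s)‖ ^ 2 ≤ (∑ s ∈ Ico a b, ‖w (s + 1) - w s‖) ^ 2 := by
        gcongr; exact norm_sum_le _ _
    _ ≤ (Ico a b).card * ∑ s ∈ Ico a b, ‖w (s + 1) - w s‖ ^ 2 := sq_sum_le_card_mul_sum_sq
    _ = (b - a : ℕ) * ∑ s ∈ Ico a b, ‖w (s + 1) - w s‖ ^ 2 := by rw [Nat.card_Ico]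

omit [NeZero n] hM [DecidablePred S] in
/-- **THE FIBER COUNT**: `Σ_j G (j[ν ↦ c]) = n·Σ_{j : j ν = c} G j`. [folklore] -/
theorem sum_update_eq {β : Type*} [AddCommMonoid β] (G : (Fin d → Fin n) → β) (c : Fin n) :
    ∑ j, G (Function.update j ν c) = n • ∑ j ∈ univ.filter (fun j : Fin d → Fin n => j ν = c), G j := by
  rw [← Finset.sum_fiberwise_of_maps_to (s := (univ : Finset (Fin d → Fin n))) (t := (univ : Finset (Fin n)))
    (g := fun j => j ν) (fun _ _ => mem_univ _)]
  have hfib : ∀ a : Fin n, ∑ j ∈ univ.filter (fun j : Fin d → Fin n => j ν = a), G (Function.update j ν c)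
      = ∑ j ∈ univ.filter (fun j : Fin d → Fin n => j ν = c), G j := by
    intro a
    refine Finset.sum_nbij' (fun j => Function.update j ν c) (fun j => Function.update j ν a) ?_ ?_ ?_ ?_ ?_
    · intro j _; simp
    · intro j _; simp
    · intro j hj
      rw [mem_filter] at hj
      rw [Function.update_idem, ← hj.2, Function.update_eq_self]
    · intro j hj
      rw [mem_filter] at hj
      rw [Function.update_idem, ← hj.2, Function.update_eq_self]
    · intro j _; rfl
  simp_rw [hfib]
  rw [Finset.sum_const, card_univ, Fintype.card_fin]

end Chart

/-! ## §2 Interior differences read on all bonds; the block mean vs the face mean -/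

section Region

variable (ν : Fin d)

/-- the INTERIOR DIFFERENCE ENERGY read on all bonds: `‖igrad_μ B (c)‖²` on star bonds, `0` elsewhere. [folklore] -/
def gI (μ : Fin d) (B : {b // starReg n M S b} → ℂ) (c : Tor (fine n M) × Fin d) : ℝ :=
  if h : starReg n M S c then ‖igrad M S n μ B ⟨c, h⟩‖ ^ 2 else 0

/-- `0 ≤ gI`. [folklore] -/
theorem gI_nonneg (μ : Fin d) (B : {b // starReg n M S b} → ℂ) (c : Tor (fine n M) × Fin d) : 0 ≤ gI n M S μ B c := by
  unfold gI; split_ifs <;> positivity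

/-- **`Σ_c gI_μ(c) = nsq (igrad_μ B)`**. [folklore] -/
theorem sum_gI_eq (μ : Fin d) (B : {b // starReg n M S b} → ℂ) : ∑ c, gI n M S μ B c = nsq (igrad M S n μ B) := by
  unfold nsq gI
  rw [← Fintype.sum_subtype_add_sum_subtype (starReg n M S) (fun c => if h : starReg n M S c then ‖igrad M S n μ B ⟨c, h⟩‖ ^ 2 else 0)]
  have h0 : ∑ c : {c // ¬ starReg n M S c}, (if h : starReg n M S c.1 then ‖igrad M S n μ B ⟨c.1, h⟩‖ ^ 2 else 0) = 0 :=
    Finset.sum_eq_zero fun c _ => dif_neg c.2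
  rw [h0, add_zero]
  exact Finset.sum_congr rfl fun c _ => dif_pos c.2

/-- on a star bond whose `μ`-translate is star, `gI_μ` IS the squared difference of the zero-extension: `n²·‖ιB(c + e_μ) − ιB(c)‖²`. [folklore] -/
theorem gI_eq_of_star (μ : Fin d) (B : {b // starReg n M S b} → ℂ) (c : Tor (fine n M) × Fin d) (hc : starReg n M S c)
    (hc' : starReg n M S (c.1 + unitVec (fine n M) μ, c.2)) :
    gI n M S μ B c = (n : ℝ) ^ 2 * ‖ext (starReg n M S) B (c.1 + unitVec (fine n M) μ, c.2) - ext (starReg n M S) B c‖ ^ 2 := by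
  unfold gI igrad
  rw [dif_pos hc, dif_pos hc', ext_apply_of _ _ ⟨_, hc'⟩, ext_apply_of _ _ ⟨c, hc⟩, norm_mul, Complex.norm_natCast, mul_pow]

omit [DecidablePred S] in
/-- sites of a block of `S` are in `Ω`. [folklore] -/
theorem blockReg_bpt {y : Tor M} (hy : S y) (j : Fin d → Fin n) : blockReg n M S (bpt n M y j) := by
  show S (blockOf n M (bpt n M y j)); rw [blockOf_bpt]; exact hy

omit [DecidablePred S] in
/-- bonds at sites of `Ω` are star bonds. [folklore] -/
theorem star_of_blockReg {x : Tor (fine n M)} (hx : blockReg n M S x) (μ : Fin d) : starReg n M S (x, μ) := Or.inl hx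

/-- **THE FACE MEAN IN THE CHART**: `Φ(B)(y,ν) = faceW·Σ_{j : j_ν + 1 = n} ιB(bpt y j, ν)`. [folklore] -/
theorem faceAvg_mulVec_apply (B : {b // starReg n M S b} → ℂ) (y : Tor M) :
    (faceAvg n M S *ᵥ B) (y, ν)
      = faceW d n * ∑ j ∈ univ.filter (fun j : Fin d → Fin n => (j ν : ℕ) + 1 = n), ext (starReg n M S) B (bpt n M y j, ν) := by
  simp only [Matrix.mulVec, dotProduct]
  -- read the sum over star bonds as a sum over all bonds of the zero-extension
  have h1 : ∑ b : {b // starReg n M S b}, faceAvg n M S (y, ν) b * B b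
      = ∑ c : Tor (fine n M) × Fin d, (if c.2 = ν ∧ blockOf n M c.1 = y ∧ edig n M ν c.1 + 1 = n then faceW d n else 0)
          * ext (starReg n M S) B c := by
    rw [← Fintype.sum_subtype_add_sum_subtype (starReg n M S) (fun c : Tor (fine n M) × Fin d =>
      (if c.2 = ν ∧ blockOf n M c.1 = y ∧ edig n M ν c.1 + 1 = n then faceW d n else 0) * ext (starReg n M S) B c)]
    have h0 : ∑ c : {c // ¬ starReg n M S c}, (if c.1.2 = ν ∧ blockOf n M c.1.1 = y ∧ edig n M ν c.1.1 + 1 = n then faceW d n else 0)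
        * ext (starReg n M S) B c.1 = 0 := Finset.sum_eq_zero fun c _ => by rw [ext_apply_of_not _ _ c.2, mul_zero]
    rw [h0, add_zero]
    refine Finset.sum_congr rfl fun b _ => ?_
    rw [ext_apply_of]; rfl
  rw [h1, Fintype.sum_prod_type_right]
  rw [Finset.sum_eq_single ν (fun μ _ hμ => Finset.sum_eq_zero fun x _ => by rw [if_neg (fun h => hμ h.1), zero_mul])
    (fun h => absurd (mem_univ _) h)]
  rw [sum_blocks n M (fun x => (if ν = ν ∧ blockOf n M x = y ∧ edig n M ν x + 1 = n then faceW d n else 0) * ext (starReg n M S) B (x, ν))]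
  rw [Finset.sum_eq_single y (fun y' _ hy' => Finset.sum_eq_zero fun j _ => by
      rw [if_neg, zero_mul]; rintro ⟨-, h, -⟩; exact hy' (by rw [blockOf_bpt] at h; exact h)) (fun h => absurd (mem_univ _) h)]
  rw [Finset.mul_sum, Finset.sum_filter]
  refine Finset.sum_congr rfl fun j _ => ?_
  simp only [blockOf_bpt, edig_bpt, true_and]
  split_ifs <;> simp

omit [NeZero n] hM [DecidablePred S] in
/-- `faceW = (1/n^d)·n`. [folklore] -/
theorem faceW_eq : faceW d n = (1 / (n : ℂ) ^ d) * n := by unfold faceW; ring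

/-- **THE BLOCK MEAN AND THE FACE MEAN DIFFER BY IN-BLOCK `ν`-DIFFERENCES** (block `y ∈ S`):
`n^d·‖(Q′ ιB_ν)(y) − Φ(B)(y,ν)‖² ≤ Σ_{j : j_ν + 1 < n} gI_ν(bpt y j, ν)`. [folklore] -/
theorem nsq_blockMean_sub_faceAvg_le (B : {b // starReg n M S b} → ℂ) {y : Tor M} (hy : S y) :
    (n : ℝ) ^ d * ‖(QsOp n M *ᵥ fun x => ext (starReg n M S) B (x, ν)) y - (faceAvg n M S *ᵥ B) (y, ν)‖ ^ 2
      ≤ ∑ j ∈ univ.filter (fun j : Fin d → Fin n => (j ν : ℕ) + 1 < n), gI n M S ν B (bpt n M y j, ν) := by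
  have hn : (0 : ℝ) < n := by exact_mod_cast Nat.pos_of_ne_zero (NeZero.ne n)
  have hn1 : 1 ≤ n := Nat.one_le_iff_ne_zero.mpr (NeZero.ne n)
  set f : Tor (fine n M) × Fin d → ℂ := ext (starReg n M S) B with hf
  -- the column values
  set w : (Fin d → Fin n) → ℕ → ℂ := fun j r => f (col n M ν y j r, ν) with hw
  -- (a) the block mean in the chart
  have hQ : (QsOp n M *ᵥ fun x => f (x, ν)) y = 1 / (n : ℂ) ^ d * ∑ j : Fin d → Fin n, w j (j ν : ℕ) := by
    rw [QsOp_mulVec]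
    congr 1
    exact Finset.sum_congr rfl fun j _ => by simp only [hw, col_digit]
  -- (b) the face mean in the chart, via the fiber count at the last digit
  have hF : (faceAvg n M S *ᵥ B) (y, ν) = 1 / (n : ℂ) ^ d * ∑ j : Fin d → Fin n, w j (n - 1) := by
    rw [faceAvg_mulVec_apply, faceW_eq, mul_assoc]
    congr 1
    have e1 : ∑ j : Fin d → Fin n, w j (n - 1) = ∑ j : Fin d → Fin n, (fun j' => f (bpt n M y j', ν)) (Function.update j ν (lastD n)) := by
      refine Finset.sum_congr rfl fun j _ => ?_
      rw [hw]; simp only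
      rw [col_of_lt n M ν y j (Nat.sub_lt (Nat.pos_of_ne_zero (NeZero.ne n)) Nat.one_pos)]; rfl
    rw [e1, sum_update_eq n ν (fun j' => f (bpt n M y j', ν)) (lastD n), nsmul_eq_mul]
    congr 1
    refine Finset.sum_congr ?_ fun _ _ => rfl
    ext j
    simp only [mem_filter, mem_univ, true_and, lastD, Fin.ext_iff]
    omega
  -- (c) the difference
  have hdiff : (QsOp n M *ᵥ fun x => f (x, ν)) y - (faceAvg n M S *ᵥ B) (y, ν)
      = 1 / (n : ℂ) ^ d * ∑ j : Fin d → Fin n, (w j (j ν : ℕ) - w j (n - 1)) := by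
    rw [hQ, hF, ← mul_sub, Finset.sum_sub_distrib]
  -- (d) per-column telescoping, every pair in the block is star–star
  have hcol : ∀ j : Fin d → Fin n, ‖w j (j ν : ℕ) - w j (n - 1)‖ ^ 2
      ≤ n * ∑ s ∈ range (n - 1), ‖w j (s + 1) - w j s‖ ^ 2 := by
    intro j
    have hj : (j ν : ℕ) ≤ n - 1 := by have := (j ν).isLt; omega
    rw [norm_sub_rev]
    refine (norm_sub_sq_le_path (w j) hj).trans ?_
    have h2 : ((n - 1 - (j ν : ℕ) : ℕ) : ℝ) ≤ n := by
      have : n - 1 - (j ν : ℕ) ≤ n := by omega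
      exact_mod_cast this
    refine mul_le_mul h2 (Finset.sum_le_sum_of_subset_of_nonneg (fun s hs => ?_) fun _ _ _ => by positivity) ?_ hn.le
    · rw [mem_Ico] at hs; rw [mem_range]; omega
    · exact Finset.sum_nonneg fun _ _ => by positivity
  have hpair : ∀ (j : Fin d → Fin n), ∀ s ∈ range (n - 1), ‖w j (s + 1) - w j s‖ ^ 2 = ((n : ℝ) ^ 2)⁻¹ * gI n M S ν B (col n M ν y j s, ν) := by
    intro j s hs
    rw [mem_range] at hs
    have hs1 : s < n := by omega
    have hs2 : s + 1 < n := by omega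
    have hc : starReg n M S (col n M ν y j s, ν) := by
      rw [col_of_lt n M ν y j hs1]; exact star_of_blockReg n M S (blockReg_bpt n M S hy _) ν
    have hc' : starReg n M S (col n M ν y j s + unitVec (fine n M) ν, ν) := by
      rw [← col_succ, col_of_lt n M ν y j hs2]; exact star_of_blockReg n M S (blockReg_bpt n M S hy _) ν
    rw [gI_eq_of_star n M S ν B _ hc hc', ← col_succ, ← mul_assoc, inv_mul_cancel₀ (by positivity), one_mul]
  -- (e) Cauchy–Schwarz over the columns
  have hcs : ‖∑ j : Fin d → Fin n, (w j (j ν : ℕ) - w j (n - 1))‖ ^ 2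
      ≤ (n : ℝ) ^ d * ∑ j : Fin d → Fin n, ‖w j (j ν : ℕ) - w j (n - 1)‖ ^ 2 := by
    calc ‖∑ j : Fin d → Fin n, (w j (j ν : ℕ) - w j (n - 1))‖ ^ 2
        ≤ (∑ j : Fin d → Fin n, ‖w j (j ν : ℕ) - w j (n - 1)‖) ^ 2 := by gcongr; exact norm_sum_le _ _
      _ ≤ (univ : Finset (Fin d → Fin n)).card * ∑ j : Fin d → Fin n, ‖w j (j ν : ℕ) - w j (n - 1)‖ ^ 2 := sq_sum_le_card_mul_sum_sq
      _ = (n : ℝ) ^ d * ∑ j : Fin d → Fin n, ‖w j (j ν : ℕ) - w j (n - 1)‖ ^ 2 := by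
          rw [card_univ, Fintype.card_fun, Fintype.card_fin, Fintype.card_fin, Nat.cast_pow]
  -- (f) the fiber count at digit 0 turns `(1/n)·Σ_j Σ_{s<n-1} gI(col j s)` into the in-block sum
  have hfib : ∑ j : Fin d → Fin n, ∑ s ∈ range (n - 1), gI n M S ν B (col n M ν y j s, ν)
      = n * ∑ j ∈ univ.filter (fun j : Fin d → Fin n => (j ν : ℕ) + 1 < n), gI n M S ν B (bpt n M y j, ν) := by
    rw [Finset.sum_comm]
    have e1 : ∀ s : ℕ, s < n → ∑ j : Fin d → Fin n, gI n M S ν B (col n M ν y j s, ν)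
        = n * ∑ j ∈ univ.filter (fun j : Fin d → Fin n => (j ν : ℕ) = s), gI n M S ν B (bpt n M y j, ν) := by
      intro s hs1
      have e2 := sum_update_eq n ν (fun j => gI n M S ν B (bpt n M y j, ν)) ⟨s, hs1⟩
      rw [nsmul_eq_mul] at e2
      rw [show (univ.filter (fun j : Fin d → Fin n => (j ν : ℕ) = s)) = univ.filter (fun j : Fin d → Fin n => j ν = ⟨s, hs1⟩) from by
        ext j; simp only [mem_filter, mem_univ, true_and, Fin.ext_iff], ← e2]
      exact Finset.sum_congr rfl fun j _ => by rw [col_of_lt n M ν y j hs1]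
    rw [Finset.sum_congr rfl (fun s hs => e1 s (by rw [mem_range] at hs; omega)), ← Finset.mul_sum]
    congr 1
    -- regroup the fibers `j ν = s`, `s < n − 1`, into the filter `j ν + 1 < n`
    rw [← Finset.sum_fiberwise_of_maps_to (s := univ.filter (fun j : Fin d → Fin n => (j ν : ℕ) + 1 < n)) (t := range (n - 1))
      (g := fun j => (j ν : ℕ)) (fun j hj => by rw [mem_filter] at hj; rw [mem_range]; omega)]
    refine Finset.sum_congr rfl fun s hs => Finset.sum_congr ?_ fun _ _ => rfl
    ext j
    simp only [mem_filter, mem_univ, true_and]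
    constructor
    · intro h; rw [mem_range] at hs; omega
    · rintro ⟨-, h⟩; exact h
  -- assemble
  rw [hdiff, norm_mul, mul_pow, norm_div, norm_one, norm_pow, Complex.norm_natCast]
  have hpow : (0 : ℝ) < (n : ℝ) ^ d := by positivity
  calc (n : ℝ) ^ d * ((1 / (n : ℝ) ^ d) ^ 2 * ‖∑ j : Fin d → Fin n, (w j (j ν : ℕ) - w j (n - 1))‖ ^ 2)
      ≤ (n : ℝ) ^ d * ((1 / (n : ℝ) ^ d) ^ 2 * ((n : ℝ) ^ d * ∑ j : Fin d → Fin n, ‖w j (j ν : ℕ) - w j (n - 1)‖ ^ 2)) := by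
        gcongr
    _ = ∑ j : Fin d → Fin n, ‖w j (j ν : ℕ) - w j (n - 1)‖ ^ 2 := by field_simp
    _ ≤ ∑ j : Fin d → Fin n, (n * ∑ s ∈ range (n - 1), ‖w j (s + 1) - w j s‖ ^ 2) := Finset.sum_le_sum fun j _ => hcol j
    _ = ∑ j : Fin d → Fin n, (n * ∑ s ∈ range (n - 1), ((n : ℝ) ^ 2)⁻¹ * gI n M S ν B (col n M ν y j s, ν)) :=
        Finset.sum_congr rfl fun j _ => by rw [Finset.sum_congr rfl (hpair j)]
    _ = (n : ℝ)⁻¹ * ∑ j : Fin d → Fin n, ∑ s ∈ range (n - 1), gI n M S ν B (col n M ν y j s, ν) := by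
        rw [Finset.mul_sum]
        refine Finset.sum_congr rfl fun j _ => ?_
        rw [← Finset.mul_sum, ← mul_assoc]
        congr 1
        field_simp
    _ = ∑ j ∈ univ.filter (fun j : Fin d → Fin n => (j ν : ℕ) + 1 < n), gI n M S ν B (bpt n M y j, ν) := by
        rw [hfib, ← mul_assoc, inv_mul_cancel₀ hn.ne', one_mul]

end Region

end Summit.QuantumFields.BalabanUV.T4Continuum.RegionFaceFluxChart

end
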